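import Literature.AlgebraicGeometry.Motives.StandardConjecturesClambdaAlgebraicProofs
import Literature.AlgebraicGeometry.Motives.StandardConjecturesKunnethSl2Proofs
import Literature.AlgebraicGeometry.Motives.StandardConjecturesRationalStructureProofs
import HarnessLib

/-!
# Discharged facts: `D(X × X) ⇒ B(X)` (Kleiman 1968, Thm. 2.9) and hodge.S29 `D ⇔ B` given `Hdg`

`Literature.AlgebraicGeometry.Motives.StandardConjectures` records as named facts (hodge.S29)

* `standardConjectureB_of_standardConjectureD_tensor`: under hard Lefschetz, for `X` smooth
  projective of dimension `n` with hyperplane class `η`, if homological and numerical equivalence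
  agree on `X × X` (`D(X × X)`), then Grothendieck's standard conjecture of Lefschetz type
  `B(X, η)` holds (`θ`-form) — S. Kleiman, *Algebraic cycles and the Weil conjectures* (1968),
  Thm. 2.9 (`A(X × X, L ⊗ 1 + 1 ⊗ L) ⇒ B(X)`) with §3 (`D(Y) ⇒ A(Y, L)`, Thm. 3.5); S. Kleiman,
  *The standard conjectures* (1994), §5; Y. André, *Une introduction aux motifs* (2004), §5;
* `standardConjectureD_iff_standardConjectureB_of_hodgeStandardConjecture`: under hard Lefschetz
  and the Hodge standard conjecture, `D` holds for all `X` iff `B` holds for all `(X, η)`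
  (Grothendieck 1969 §4; Kleiman 1968 §3).

This file **proves both** (`standardConjectureB_of_standardConjectureD_tensor_holds`,
`standardConjectureD_iff_standardConjectureB_of_hodgeStandardConjecture_holds`), formally in the
axioms of `Literature.AlgebraicGeometry.Motives.WeilCohomology` plus the hypotheses, on top of:
the `𝔰𝔩₂`-calculus of `ᶜΛ` and its Künneth transport `ᶜΛ₁₂ = ᶜΛ ⊗ 1 + 1 ⊗ ᶜΛ` to `X × X` with the
product polarisation `η₁₂ = η ⊠ 1 + 1 ⊠ η` (`StandardConjecturesSl2Proofs`,
`StandardConjecturesKunnethSl2Proofs`: hard Lefschetz for `η₁₂`, primitive classes are lowest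
weight vectors, the adjunction formula `trace_cup_clambdaKunneth`), the criterion "`ᶜΛ` algebraic
⇒ `B(X)`" (`StandardConjecturesClambdaAlgebraicProofs`, Kleiman 1968 Prop. 2.3), the finiteness
theorem `D(Y) ⇒ A(Y, u)` (`StandardConjecturesRationalStructureProofs`, Kleiman 1968 Thm. 3.5), and
the half `B ∧ Hdg ⇒ D` with the reduction of hodge.S29 to `D(X × X) ⇒ B(X)`
(`StandardConjecturesProofs`).

## The argument for `D(X × X) ⇒ B(X)` (Kleiman 1968, proof of Thm. 2.9, in pairing form)

Let `Y = X × X` (smooth projective of dimension `2n`, `IsSmoothProjective.tensor_holds`),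
`L₁₂ = (· ∪ η₁₂)`; `η₁₂ ∈ A¹(Y)_ℚ`, so `L₁₂ʷ` maps `Aᵖ(Y)_ℚ` into `Aᵖ⁺ʷ(Y)_ℚ`
(`prod_lefschetzPow_mem_ratAlgebraicClasses`).
1. **`A(Y, L₁₂)`** (`exists_prod_lefschetzPow_eq_of_standardConjectureD`): for `p + q = 2n` the
   injective (hard Lefschetz, `prod_lefschetzPow_injective`) map `L₁₂ʷ : Aᵖ(Y)_ℚ → Aᵠ(Y)_ℚ` is
   onto, by `D(Y)` and Kleiman's Thm. 3.5 (`exists_mem_ratAlgebraicClasses_eq_of_standardConjectureD`).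
2. **`ᶜΛ₁₂` preserves `A(Y)_ℚ`** (`clambdaKunneth_mem_ratAlgebraicClasses`), by strong induction on
   the degree: `A(Y, L₁₂)` yields the two-step Lefschetz decomposition `x = x₀ + L₁₂ x'` of an
   algebraic class with `x₀` primitive and `x'` algebraic; `ᶜΛ₁₂ x₀ = 0`
   (`clambdaKunneth_eq_zero_of_primitive`) and `ᶜΛ₁₂ (L₁₂ x') = L₁₂ (ᶜΛ₁₂ x') - (deg x' - 2n) x'`
   (`prod_lefschetz_clambda_sub`) is algebraic by induction; above the middle degree
   `x = L₁₂ʷ x''` with `x''` algebraic.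
3. **The class of `ᶜΛ`** (`isInducedBy_clambdaOp`): if `Δ ∈ Aⁿ(Y)_ℚ` induces the identity
   (axiom `exists_isInducedBy_id`), then `ᶜΛ₁₂ Δ` induces `ᶜΛ ∘ id + id ∘ ᶜΛ` in Kleiman's pairing
   form (`trace_cup_clambdaKunneth`), i.e. `2 ᶜΛ` by the symmetry of `ᶜΛ` for the Poincaré pairing
   (`cupPairing_clambdaOp_left`); so `½ ᶜΛ₁₂ Δ ∈ Aⁿ⁻¹(Y)_ℚ` (step 2, divisibility) induces every
   component of `ᶜΛ`, which is therefore an algebraic graded operator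
   (`isAlgebraicGradedOp_clambdaOp_of_standardConjectureD`; for `n = 0`, `ᶜΛ = 0`).
4. `B(X, η)` by `standardConjectureB_of_isAlgebraicGradedOp_clambdaOp`.

Everything is a theorem; no definition and no named fact is introduced; nothing of
`StandardConjectures.lean` is restated or modified.

## References

* S. Kleiman, *Algebraic cycles and the Weil conjectures*, in: Dix exposés sur la cohomologie des
  schémas, North-Holland (1968), 359–386, §2 (Prop. 2.3, Thm. 2.9), §3 (Thm. 3.5).
  [Kleiman1968AlgebraicCycles]
* S. Kleiman, *The standard conjectures*, in: Motives (Seattle 1991), Proc. Sympos. Pure Math. 55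
  Part 1 (1994), 3–20, §§4–5. [Kleiman1994StandardConjectures]
* A. Grothendieck, *Standard conjectures on algebraic cycles* (Bombay 1968), Oxford (1969), §4.
  [Grothendieck1969StandardConjectures]
* J. P. Murre, *Lectures on motives* (Grenoble 2001), LMS Lecture Note Ser. 313 (2004), §4.2.1,
  §4.2.2.4 Lemma 1. [Murre2004LecturesMotives]
-/

universe u v

open CategoryTheory AlgebraicGeometry MonoidalCategory CartesianMonoidalCategory
open scoped TensorProduct

noncomputable section

namespace Literature.AlgebraicGeometry.Motives

namespace WeilCohomology

variable {k : Type u} [Field k] {K : Type v} [Field K] [CharZero K] (W : WeilCohomology k K)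
variable {n : ℕ} {X : SchemeOver k} {η : W.obj X 2}

/-! ## `L₁₂` preserves algebraic classes; `A(X × X, L₁₂)` from `D(X × X)` -/

/-- The iterated Lefschetz operator `L₁₂ʷ` of the product polarisation `η₁₂ = η ⊠ 1 + 1 ⊠ η` maps
`Aᵖ(X × X)_ℚ` into `Aᵖ⁺ʷ(X × X)_ℚ` (`η₁₂` is rational algebraic,
`prodClass_mem_ratAlgebraicClasses`; `cup_mem_ratAlgebraicClasses`). [folklore] -/
theorem prod_lefschetzPow_mem_ratAlgebraicClasses (hX : IsSmoothProjective n X)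
    (hη : W.IsHyperplaneClass X η) {p w q : ℕ} (hq : p + w = q) (h : 2 * p + 2 * w = 2 * q)
    {x : W.obj (X ⊗ X) (2 * p)} (hx : x ∈ W.ratAlgebraicClasses (X ⊗ X) p) :
    W.lefschetzPow (X ⊗ X) (W.prodClass η) w (2 * p) (2 * q) h x ∈
      W.ratAlgebraicClasses (X ⊗ X) q := by
  have hXX := isSmoothProjective_tensor hX hX
  have hη₁₂ := W.prodClass_mem_ratAlgebraicClasses hX
    (W.mem_ratAlgebraicClasses_of_isHyperplaneClass hX hη) (W.one_mem_ratAlgebraicClasses hX)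
  subst hq
  show W.cup h x (W.pow (X ⊗ X) (W.prodClass η) w) ∈ _
  exact W.cup_mem_ratAlgebraicClasses hXX rfl x _ hx (W.pow_mem_ratAlgebraicClasses hXX hη₁₂ w)

/-- **`D(X × X) ⇒ A(X × X, L ⊗ 1 + 1 ⊗ L)`** (Kleiman 1968 §3 with Thm. 3.5: under `D(Y)` the
injective hard-Lefschetz map `L₁₂ʷ : Aᵖ(Y)_ℚ → Aᵠ(Y)_ℚ`, `p + q = dim Y`, between `ℚ`-vector
spaces of the same finite dimension is onto; `Y = X × X` with the product polarisation, whose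
hard Lefschetz property is `prod_lefschetzPow_injective`). For `p + q = 2n`, `p + w = q`, every
`y ∈ Aᵠ(X × X)_ℚ` is `L₁₂ʷ x` for some `x ∈ Aᵖ(X × X)_ℚ`. [cite: Kleiman1968AlgebraicCycles, §3 Thm. 3.5] -/
theorem exists_prod_lefschetzPow_eq_of_standardConjectureD (hL : W.HasHardLefschetz)
    (hX : IsSmoothProjective n X) (hη : W.IsHyperplaneClass X η)
    (hD : W.StandardConjectureD (n + n) (X ⊗ X)) {p w q : ℕ} (hpq : p + q = n + n)
    (hw : p + w = q) (h : 2 * p + 2 * w = 2 * q) {y : W.obj (X ⊗ X) (2 * q)}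
    (hy : y ∈ W.ratAlgebraicClasses (X ⊗ X) q) :
    ∃ x ∈ W.ratAlgebraicClasses (X ⊗ X) p,
      W.lefschetzPow (X ⊗ X) (W.prodClass η) w (2 * p) (2 * q) h x = y :=
  W.exists_mem_ratAlgebraicClasses_eq_of_standardConjectureD (isSmoothProjective_tensor hX hX) hD
    hpq _ (W.prod_lefschetzPow_injective hL hX hη (2 * p) (by omega) h)
    (fun _ hx ↦ W.prod_lefschetzPow_mem_ratAlgebraicClasses hX hη hw h hx) y hy

/-! ## `ᶜΛ₁₂` preserves algebraic classes under `D(X × X)` -/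

/-- The inductive step: if `ᶜΛ₁₂` maps `Aᵖ'(X × X)_ℚ ∋ z` into `Aᵖ'⁻¹(X × X)_ℚ`, then
`ᶜΛ₁₂ (L₁₂ z) = L₁₂ (ᶜΛ₁₂ z) - (2p' - 2n) z ∈ Aᵖ'(X × X)_ℚ` (the `𝔰𝔩₂` relation on `X × X`,
`prod_lefschetz_clambda_sub`; for `p' = 0`, `ᶜΛ₁₂ (L₁₂ z) = 2n z`). [folklore] -/
theorem clambdaKunneth_lefschetz_mem_ratAlgebraicClasses (hL : W.HasHardLefschetz)
    (hX : IsSmoothProjective n X) (hη : W.IsHyperplaneClass X η) {p' p : ℕ} (hp : p' + 1 = p)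
    (hde : 2 * p' + 2 * 1 = 2 * p) {z : W.obj (X ⊗ X) (2 * p')}
    (hz : z ∈ W.ratAlgebraicClasses (X ⊗ X) p')
    (ih : ∀ {p'' : ℕ}, p'' + 1 = p' →
      W.clambdaKunneth hL hX hη (2 * p') (2 * p'') z ∈ W.ratAlgebraicClasses (X ⊗ X) p'') :
    W.clambdaKunneth hL hX hη (2 * p) (2 * p')
        (W.lefschetzPow (X ⊗ X) (W.prodClass η) 1 (2 * p') (2 * p) hde z) ∈
      W.ratAlgebraicClasses (X ⊗ X) p' := by
  rcases Nat.eq_zero_or_pos p' with rfl | hpos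
  · rw [W.prod_clambda_lefschetz_of_le_one hL hX hη (d := 2 * 0) (by omega) hde z,
      Int.cast_smul_eq_zsmul]
    exact AddSubgroup.zsmul_mem _ hz _
  · obtain ⟨p'', hp''⟩ : ∃ p'', p'' + 1 = p' := ⟨p' - 1, by omega⟩
    have hcd : 2 * p'' + 2 * 1 = 2 * p' := by omega
    have key := W.prod_lefschetz_clambda_sub hL hX hη hcd hde z
    rw [sub_eq_iff_eq_add] at key
    have key' : W.clambdaKunneth hL hX hη (2 * p) (2 * p')
        (W.lefschetzPow (X ⊗ X) (W.prodClass η) 1 (2 * p') (2 * p) hde z) =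
      W.lefschetzPow (X ⊗ X) (W.prodClass η) 1 (2 * p'') (2 * p') hcd
          (W.clambdaKunneth hL hX hη (2 * p') (2 * p'') z) -
        ((((2 * p' : ℕ) : ℤ) - 2 * n : ℤ) : K) • z := by
      rw [key, add_sub_cancel_left]
    rw [key', Int.cast_smul_eq_zsmul]
    exact sub_mem (W.prod_lefschetzPow_mem_ratAlgebraicClasses hX hη hp'' hcd (ih hp''))
      (AddSubgroup.zsmul_mem _ hz _)

/-- **`ᶜΛ₁₂` preserves rational algebraic classes on `X × X` under `D(X × X)`** (the step
"`A(Y, L_Y) ⇒ ᶜΛ_Y` respects algebraic classes" of Kleiman 1968, Thm. 2.9 / §3, for `Y = X × X`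
with the product polarisation): for `x ∈ Aᵖ(X × X)_ℚ`, `ᶜΛ₁₂ x ∈ Aᵖ⁻¹(X × X)_ℚ`. Proof by strong
induction on `p`: for `2p ≤ 2n`, `A(X × X, L₁₂)` (`exists_prod_lefschetzPow_eq_of_standardConjectureD`)
provides `x' ∈ Aᵖ⁻¹(X × X)_ℚ` with `L₁₂ʷ⁺² x' = L₁₂ʷ⁺¹ x` (`2p + w = 2n`), so that `x₀ = x - L₁₂ x'`
is primitive, hence killed by `ᶜΛ₁₂` (`clambdaKunneth_eq_zero_of_primitive`), and
`ᶜΛ₁₂ x = ᶜΛ₁₂ (L₁₂ x')` is algebraic by the inductive step; for `2p > 2n`, `x = L₁₂ʷ x''` with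
`x'' ∈ A²ⁿ⁻ᵖ(X × X)_ℚ` algebraic, again by `A(X × X, L₁₂)`. [cite: Kleiman1968AlgebraicCycles, Thm. 2.9] -/
theorem clambdaKunneth_mem_ratAlgebraicClasses (hL : W.HasHardLefschetz)
    (hX : IsSmoothProjective n X) (hη : W.IsHyperplaneClass X η)
    (hD : W.StandardConjectureD (n + n) (X ⊗ X)) (p : ℕ) :
    ∀ {p' : ℕ} (_ : p' + 1 = p) {x : W.obj (X ⊗ X) (2 * p)}
      (_ : x ∈ W.ratAlgebraicClasses (X ⊗ X) p),
      W.clambdaKunneth hL hX hη (2 * p) (2 * p') x ∈ W.ratAlgebraicClasses (X ⊗ X) p' := by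
  have hXX := isSmoothProjective_tensor hX hX
  induction p using Nat.strong_induction_on with | _ p ih => ?_
  intro p' hp x hx
  have hde : 2 * p' + 2 * 1 = 2 * p := by omega
  -- the induction hypothesis in degree `p'`, in the form of the inductive step
  have ih' : ∀ {z : W.obj (X ⊗ X) (2 * p')}, z ∈ W.ratAlgebraicClasses (X ⊗ X) p' →
      ∀ {p'' : ℕ}, p'' + 1 = p' →
        W.clambdaKunneth hL hX hη (2 * p') (2 * p'') z ∈ W.ratAlgebraicClasses (X ⊗ X) p'' :=
    fun hz _ hp'' ↦ ih p' (by omega) hp'' hz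
  by_cases hle : 2 * p ≤ n + n
  · -- `2p + w = 2n`; two-step Lefschetz decomposition `x = x₀ + L₁₂ x'`
    obtain ⟨w, hw⟩ : ∃ w, 2 * p + w = n + n := ⟨n + n - 2 * p, by omega⟩
    have h1 : 2 * p + 2 * (w + 1) = 2 * (p + w + 1) := by omega
    have h2 : 2 * p' + 2 * (w + 2) = 2 * (p + w + 1) := by omega
    have hLx := W.prod_lefschetzPow_mem_ratAlgebraicClasses hX hη
      (show p + (w + 1) = p + w + 1 by omega) h1 hx
    obtain ⟨x', hx', hx'eq⟩ := W.exists_prod_lefschetzPow_eq_of_standardConjectureD hL hX hη hD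
      (p := p') (q := p + w + 1) (w := w + 2) (by omega) (by omega) h2 hLx
    set x₀ := x - W.lefschetzPow (X ⊗ X) (W.prodClass η) 1 (2 * p') (2 * p) hde x' with hx₀
    have hx₀prim : W.lefschetzPow (X ⊗ X) (W.prodClass η) (w + 1) (2 * p) (2 * (p + w + 1)) h1 x₀
        = 0 := by
      rw [hx₀, map_sub, W.lefschetzPow_lefschetzPow hXX _ (show 1 + (w + 1) = w + 2 by omega) hde
        h1 h2 x', hx'eq, sub_self]
    have hF0 : W.clambdaKunneth hL hX hη (2 * p) (2 * p') x₀ = 0 :=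
      W.clambdaKunneth_eq_zero_of_primitive hL hX hη (c := 2 * p') (by omega) hw h1 hx₀prim
    have hxdec : x = x₀ + W.lefschetzPow (X ⊗ X) (W.prodClass η) 1 (2 * p') (2 * p) hde x' := by
      rw [hx₀, sub_add_cancel]
    rw [hxdec, map_add, hF0, zero_add]
    exact W.clambdaKunneth_lefschetz_mem_ratAlgebraicClasses hL hX hη hp hde hx' (ih' hx')
  · by_cases hpN : p ≤ n + n
    · -- `2p > 2n`: `x = L₁₂ʷ⁺¹ x''` with `x'' ∈ A²ⁿ⁻ᵖ(X × X)_ℚ`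
      obtain ⟨q, hq⟩ : ∃ q, p + q = n + n := ⟨n + n - p, by omega⟩
      obtain ⟨w, hw⟩ : ∃ w, q + (w + 1) = p := ⟨p - q - 1, by omega⟩
      have h3 : 2 * q + 2 * (w + 1) = 2 * p := by omega
      have h4 : 2 * q + 2 * w = 2 * p' := by omega
      obtain ⟨x'', hx'', hx''eq⟩ := W.exists_prod_lefschetzPow_eq_of_standardConjectureD hL hX hη
        hD (p := q) (q := p) (w := w + 1) (by omega) hw h3 hx
      have hz := W.prod_lefschetzPow_mem_ratAlgebraicClasses hX hη (show q + w = p' by omega) h4 hx''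
      have hxz : x = W.lefschetzPow (X ⊗ X) (W.prodClass η) 1 (2 * p') (2 * p) hde
          (W.lefschetzPow (X ⊗ X) (W.prodClass η) w (2 * q) (2 * p') h4 x'') := by
        rw [W.lefschetzPow_lefschetzPow hXX _ (show w + 1 = w + 1 from rfl) h4 hde h3 x'', hx''eq]
      rw [hxz]
      exact W.clambdaKunneth_lefschetz_mem_ratAlgebraicClasses hL hX hη hp hde hz (ih' hz)
    · -- `p > 2n`: `H²ᵖ(X × X) = 0`
      have hx0 : x = 0 := W.eq_zero_of_lt hXX (by omega) x
      rw [hx0, map_zero]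
      exact zero_mem _

/-! ## The class `½ ᶜΛ₁₂ Δ` induces `ᶜΛ` -/

/-- **The Künneth–Poincaré dictionary for `ᶜΛ`** (Kleiman 1968, Thm. 2.9: under
`End(H•(X)) ≅ H•(X × X)`, if `u` induces `T` then `ᶜΛ₁₂ u` induces `ᶜΛ ∘ T + T ∘ ᶜΛ`; with
`u = Δ`, `T = id`, and the symmetry of `ᶜΛ` for the Poincaré pairing, `ᶜΛ₁₂ Δ` induces `2 ᶜΛ`):
if `Δ ∈ H²ⁿ(X × X)` induces the identity of every `Hⁱ(X)`, then for `c + 1 = n` the class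
`½ ᶜΛ₁₂ Δ ∈ H²ᶜ(X × X)` induces the component `ᶜΛ : Hⁱ(X) → Hʲ(X)`, `j + 2 = i`, in Kleiman's
pairing form. [cite: Kleiman1968AlgebraicCycles, Thm. 2.9] -/
theorem isInducedBy_clambdaOp (hL : W.HasHardLefschetz) (hX : IsSmoothProjective n X)
    (hη : W.IsHyperplaneClass X η) {Δ : W.obj (X ⊗ X) (2 * n)}
    (hΔ : ∀ (i j' : ℕ) (hj : i + j' = 2 * n),
      W.IsInducedBy n n Δ (LinearMap.id : W.obj X i →ₗ[K] W.obj X i) hj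
        (show i + 2 * n + j' = 2 * (n + n) by omega))
    {c : ℕ} (hc : c + 1 = n) {i j j' : ℕ} (hij : j + 2 = i) (hj : j + j' = 2 * n)
    (hm : i + 2 * c + j' = 2 * (n + n)) :
    W.IsInducedBy n n (((2⁻¹ : ℚ) : K) • W.clambdaKunneth hL hX hη (2 * n) (2 * c) Δ)
      (W.clambdaOp hL hX hη i j) hj hm := by
  intro x y
  simp only [map_smul, LinearMap.smul_apply, smul_eq_mul]
  by_cases hj2 : 2 ≤ j'
  · obtain ⟨b₂, hb⟩ : ∃ b₂, b₂ + 2 = j' := ⟨j' - 2, by omega⟩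
    have h₁ : j + 2 * n + j' = 2 * (n + n) := by omega
    have h₂ : i + 2 * n + b₂ = 2 * (n + n) := by omega
    rw [W.trace_cup_clambdaKunneth hL hX hη (m := 2 * n) (m' := 2 * c) (by omega) hij hb hm h₁ h₂
      Δ x y, ← hΔ j j' hj (W.clambdaOp hL hX hη i j x) y,
      ← hΔ i b₂ (by omega) x (W.clambdaOp hL hX hη j' b₂ y)]
    simp only [LinearMap.id_apply]
    have hsym := W.cupPairing_clambdaOp_left hL hX hη hij hb hj (show i + b₂ = 2 * n by omega) x y
    simp only [cupPairing_apply] at hsym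
    rw [← hsym, ← two_mul, ← mul_assoc, Rat.cast_inv, Rat.cast_ofNat,
      inv_mul_cancel₀ (two_ne_zero' K), one_mul]
  · -- `j' ≤ 1`, so `i > 2n` and `x = 0`
    have hx : x = 0 := W.eq_zero_of_lt hX (by omega) x
    subst hx
    simp

/-- **`ᶜΛ` is algebraic under `D(X × X)`** (Kleiman 1968, Thm. 2.9 with §3: the class of `ᶜΛ`
under the Künneth–Poincaré dictionary is `½ ᶜΛ₁₂ Δ`, and `ᶜΛ₁₂` preserves `A(X × X)_ℚ ∋ Δ`
under `A(X × X, L₁₂)`, which follows from `D(X × X)`): the graded operator `ᶜΛ` of `(X, η)` is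
induced by the rational algebraic classes `½ ᶜΛ₁₂ Δ ∈ Aᶜ(X × X)_ℚ` (nonzero only for
`c = n - 1`). [cite: Kleiman1968AlgebraicCycles, Thm. 2.9] -/
theorem isAlgebraicGradedOp_clambdaOp_of_standardConjectureD (hL : W.HasHardLefschetz)
    (hX : IsSmoothProjective n X) (hη : W.IsHyperplaneClass X η)
    (hD : W.StandardConjectureD (n + n) (X ⊗ X)) :
    W.IsAlgebraicGradedOp n n (W.clambdaOp hL hX hη) := by
  obtain ⟨Δ, hΔmem, hΔ⟩ := W.exists_isInducedBy_id hX
  have hmem : ∀ c : ℕ, ((2⁻¹ : ℚ) : K) • W.clambdaKunneth hL hX hη (2 * n) (2 * c) Δ ∈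
      W.ratAlgebraicClasses (X ⊗ X) c := by
    intro c
    by_cases hc : c + 1 = n
    · exact W.ratCast_smul_mem_ratAlgebraicClasses
        (W.clambdaKunneth_mem_ratAlgebraicClasses hL hX hη hD n hc hΔmem) _
    · rw [W.clambdaKunneth_eq_zero_of_ne hL hX hη (show 2 * c + 2 ≠ 2 * n by omega),
        LinearMap.zero_apply, smul_zero]
      exact zero_mem _
  refine ⟨fun c ↦ ⟨_, hmem c⟩, ?_, ?_⟩
  · intro i j c j' hj hm hline
    by_cases hij : j + 2 = i
    · exact W.isInducedBy_clambdaOp hL hX hη hΔ (by omega) hij hj hm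
    · rw [W.clambdaOp_eq_zero_of_ne hL hX hη hij]
      have hc : ¬ c + 1 = n := by omega
      have h0 : ((2⁻¹ : ℚ) : K) • W.clambdaKunneth hL hX hη (2 * n) (2 * c) Δ = 0 := by
        rw [W.clambdaKunneth_eq_zero_of_ne hL hX hη (show 2 * c + 2 ≠ 2 * n by omega),
          LinearMap.zero_apply, smul_zero]
      simp only [h0]
      exact W.isInducedBy_zero
  · intro i j hne
    by_cases hij : j + 2 = i
    · -- then `n = 0` and `Hⁱ(X) = 0`
      have hn : n = 0 := by
        by_contra h
        exact hne ⟨n - 1, by omega⟩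
      subst hn
      refine LinearMap.ext fun x ↦ ?_
      rw [W.eq_zero_of_lt hX (show 2 * 0 < i by omega) x, map_zero, LinearMap.zero_apply]
    · exact W.clambdaOp_eq_zero_of_ne hL hX hη hij

end WeilCohomology

/-! ## The discharge -/

section Discharge

variable {k : Type u} [Field k] {K : Type v} [Field K] [CharZero K]
variable {W : WeilCohomology k K} {n : ℕ} {X : SchemeOver k} {η : W.obj X 2}

/-- **Discharge of hodge.S29, `D(X × X) ⇒ B(X)`** (S. Kleiman, *Algebraic cycles and the Weil
conjectures* (1968), Thm. 2.9 `A(X × X, L ⊗ 1 + 1 ⊗ L) ⇒ B(X)` with §3 `D(Y) ⇒ A(Y, L)`):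
under hard Lefschetz, for `X` smooth projective of dimension `n` with hyperplane class `η`,
`D(X × X)` implies `B(X, η)` in `θ`-form. Assembled from
`isAlgebraicGradedOp_clambdaOp_of_standardConjectureD` (`ᶜΛ` is algebraic) and
`standardConjectureB_of_isAlgebraicGradedOp_clambdaOp` (`ᶜΛ` algebraic ⇒ `B(X)`, Kleiman 1968
Prop. 2.3). [cite: Kleiman1968AlgebraicCycles, Thm. 2.9 and §3] -/
theorem standardConjectureB_of_standardConjectureD_tensor_holds :
    standardConjectureB_of_standardConjectureD_tensor (W := W) (n := n) (X := X) (η := η) := by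
  intro hL hX hη hD
  exact W.standardConjectureB_of_isAlgebraicGradedOp_clambdaOp hL hX hη
    (W.isAlgebraicGradedOp_clambdaOp_of_standardConjectureD hL hX hη hD)

/-- **Discharge of hodge.S29, `D ⇔ B` in the presence of `Hdg`** (A. Grothendieck, *Standard
conjectures on algebraic cycles* (1969), §4: "in characteristic zero `B` and `D` are equivalent";
Kleiman 1968 §3 with Thm. 2.9; Kleiman 1994 §5): under hard Lefschetz and the Hodge standard
conjecture for `W`, `D` holds for every smooth projective `X` iff `B` holds for every `(X, η)`.
The reduction `standardConjectureD_iff_standardConjectureB_of_hodgeStandardConjecture_of` of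
`StandardConjecturesProofs` (`B ∧ Hdg ⇒ D` proved there) fed with
`standardConjectureB_of_standardConjectureD_tensor_holds`. [cite: Kleiman1968AlgebraicCycles, §3 and Thm. 2.9] -/
theorem standardConjectureD_iff_standardConjectureB_of_hodgeStandardConjecture_holds :
    standardConjectureD_iff_standardConjectureB_of_hodgeStandardConjecture W :=
  standardConjectureD_iff_standardConjectureB_of_hodgeStandardConjecture_of W
    fun {_ _ _} ↦ standardConjectureB_of_standardConjectureD_tensor_holds

end Discharge

end Literature.AlgebraicGeometry.Motives

end
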